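import Mathlib

/-!
# Crux-triage r1 k=1 (refuter): the first lemma of idea `spectral-floor-pricing` is FALSE as typed

`Cruxes/ExactCertificate/Ideator2Sketch.lean` states

  theorem far_modification_eq (ρ : ℝ) (hρ : 0 < ρ) (μ₁ μ₂ : Measure E3) [IsFiniteMeasure μ₁]
      [IsFiniteMeasure μ₂] (h₁ : μ₁ (ball 0 ρ) = 0) (h₂ : μ₂ (ball 0 ρ) = 0)
      (hpd : ∀ φ, Continuous φ → HasCompactSupport φ → ∫ autocorr φ ∂μ₂ ≤ ∫ autocorr φ ∂μ₁) :
      μ₁ = μ₂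

with `autocorr φ x = ∫ y, φ y * φ (y + x)`.  Since `autocorr φ` is an EVEN function, the
hypothesis `hpd` cannot distinguish a measure from its reflection: `μ₁ = δ_p`, `μ₂ = δ_{-p}`
(`‖p‖ ≥ ρ`) satisfy every hypothesis (with equality in `hpd`) and `μ₁ ≠ μ₂`.  Real test
functions only see `Re ν̂`, i.e. the even part of `ν = μ₁ − μ₂`.
Repair (true, and all the card uses): add `μ₁, μ₂` invariant under `x ↦ -x` (e.g. radial), or
conclude only that the symmetrisations agree.
-/

open MeasureTheory

noncomputable section

namespace CruxTriage11959

abbrev E3 : Type := EuclideanSpace ℝ (Fin 3)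

/-- Same definition as `autocorr` in `Ideator2Sketch.lean`. -/
def autocorr (φ : E3 → ℝ) (x : E3) : ℝ := ∫ y, φ y * φ (y + x)

theorem autocorr_neg (φ : E3 → ℝ) (x : E3) : autocorr φ (-x) = autocorr φ x := by
  unfold autocorr
  have h := integral_add_left_eq_self (μ := (volume : Measure E3))
    (fun z : E3 => φ z * φ (z + -x)) x
  rw [← h]
  congr 1
  ext y
  simp only [add_neg_cancel_comm]
  rw [mul_comm, add_comm x y]

/-- The point `2·e₀`. -/
def pt : E3 := EuclideanSpace.single 0 2

theorem norm_pt : ‖pt‖ = 2 := by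
  simp [pt]

theorem pt_ne_zero : pt ≠ 0 := by
  intro h
  have := norm_pt
  rw [h, norm_zero] at this
  norm_num at this

theorem neg_pt_ne_pt : -pt ≠ pt := by
  intro h
  have h2 : (2 : ℝ) • pt = 0 := by
    rw [two_smul]
    nth_rewrite 1 [← h]
    exact neg_add_cancel pt
  rcases smul_eq_zero.1 h2 with h' | h'
  · norm_num at h'
  · exact pt_ne_zero h'

theorem dirac_ball_eq_zero (q : E3) (hq : ‖q‖ = 2) :
    Measure.dirac q (Metric.ball (0 : E3) 1) = 0 := by
  rw [Measure.dirac_apply' _ measurableSet_ball]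
  have : q ∉ Metric.ball (0 : E3) 1 := by
    rw [Metric.mem_ball, dist_zero_right, hq]
    norm_num
  simp [this]

/-- **`far_modification_eq` (first lemma of idea spectral-floor-pricing) is false as typed.** -/
theorem far_modification_eq_false :
    ¬ ∀ (ρ : ℝ), 0 < ρ → ∀ (μ₁ μ₂ : Measure E3) [IsFiniteMeasure μ₁] [IsFiniteMeasure μ₂],
      μ₁ (Metric.ball 0 ρ) = 0 → μ₂ (Metric.ball 0 ρ) = 0 →
      (∀ φ : E3 → ℝ, Continuous φ → HasCompactSupport φ →
        ∫ x, autocorr φ x ∂μ₂ ≤ ∫ x, autocorr φ x ∂μ₁) → μ₁ = μ₂ := by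
  intro h
  have h1 := h 1 one_pos (Measure.dirac pt) (Measure.dirac (-pt)) (dirac_ball_eq_zero pt norm_pt)
    (dirac_ball_eq_zero (-pt) (by rw [norm_neg, norm_pt])) (by
      intro φ _ _
      rw [integral_dirac, integral_dirac, autocorr_neg])
  have h2 := congrArg (fun μ : Measure E3 => μ {pt}) h1
  rw [Measure.dirac_apply_of_mem (Set.mem_singleton pt),
    Measure.dirac_apply' _ (measurableSet_singleton pt)] at h2
  have hn : (-pt) ∉ ({pt} : Set E3) := by
    rw [Set.mem_singleton_iff]
    exact neg_pt_ne_pt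
  simp [hn] at h2

end CruxTriage11959

end
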